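import Literature.Analysis.FluidPDE.FluidComputer.TubeTableRun0
import Literature.Analysis.FluidPDE.FluidComputer.TubeTableRun1
import Literature.Analysis.FluidPDE.FluidComputer.TubeTableRun2
import Literature.Analysis.FluidPDE.FluidComputer.TubeTableRun3
import Literature.Analysis.FluidPDE.FluidComputer.TubeTableRun4
import Literature.Analysis.FluidPDE.FluidComputer.TubeTableRun5
import Literature.Analysis.FluidPDE.FluidComputer.TubeTableRun6
import Literature.Analysis.FluidPDE.FluidComputer.TubeTableRun7
import Literature.Analysis.FluidPDE.FluidComputer.ThresholdLevelCertificateL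
import Literature.Analysis.FluidPDE.FluidComputer.ThresholdQuiet
import HarnessLib

/-!
# Certificate: the threshold gate from its INPUT BOX to a loaded output, under forcing (bp3 gen 13)

HONEST FRAMING: low prior, high value-of-information experiment on Tao's machine paradigm; NOT a
claim that NS blows up.

THE FIRST INPUT-TO-OUTPUT CERTIFICATE OF THE THRESHOLD GATE.  For the A = 2 design point `Gt` of
the `5`-mode threshold circuit (`ε = 0.2`, `σ ≈ 3.58·10⁻⁴`, `ν = 480`, `μ = 96`, `r ≈ 1.18·10⁴`,
`κ = 4800`; `ThresholdLevelCertificate.lean`) and EVERY curve `y` that is continuous, right-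
differentiable with forcing defect at most `δ = Gt.δ ≈ 3.58·10⁻⁶` (`‖y' − F(y)‖ ≤ δ`) on the window
`[0, T12t + T₃L] ≈ [0, 1.4142]`, and that starts in the gate's INPUT BOX
(`|a − 1| ≤ 10⁻⁵`, `|b| ≤ 10⁻⁵`, `0 ≤ c ≤ 10⁻⁷`, `|d|, |ã| ≤ 5·10⁻⁶` suffice: `mem_inputBox_of`):

* stages 1–2 (pre-threshold growth of the clock `b` and the trigger `c`, then the threshold
  crossing), `tube_crossing`: the orbit stays in the cube `‖y‖∞ ≤ Rbt ≈ 1.03` and at some time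
  `s < T12t = 8863/8192` its trigger reaches the read-out level `C₋ = CLt/2^60 ≈ 1.02·10⁻⁴` (a quarter of
  the design level `C₀`) with `(a, b, d, ã)` in the hull box `HT` (`a ∈ [0.97627, 0.97657]`,
  `b ∈ [0.21246, 0.21305]`, `d ∈ [0.00612, 0.00697]`, `ã ∈ [0.03524, 0.03685]`);
* timing, `tube_no_early_output`: before `T12t ≈ 1.0819` the output mode holds at most `0.14 %` of the
  energy (`ã² ≤ 1.4·10⁻³` on `[0, T12t]`);
* hand-off, `tube_handoff`: that state lies in the entry box `AintL` of the RE-CUT transfer table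
  (`ThresholdLevelCertificateL.lean`; slaving residual by interval product, energy by the drift bound
  `|E(s) − E(0)| ≤ 10 δ Rbt s`);
* stage 3 (transfer), `recut_transfer_reach`: from `AintL` the output mode is loaded to
  `ã² ≥ EoutL ≈ 0.92240` within a further `T₃L ≈ 0.33227`;

* the complementary QUIET branch, `noInput_quiet` (`IsForcedWindow.quiet_output`,
  `ThresholdQuiet.lean`): if instead the initial energy is at most `e ≤ 1` (no structured input at
  all is required), the output mode carries at most `e + 6·10⁻⁵` at ALL times of the same window —
  so "no input pulse (energy `≤ 10⁻⁴`) ⇒ no output (`ã² ≤ 1.6·10⁻⁴`)";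

hence (`inputBox_reach_outputLoaded`) `∃ s ∈ [0, T12t + T₃L], y s 4 ^ 2 ≥ EoutL`: AT LEAST 92.2 % of
the pulse energy (input energy `≤ 1 + 3·10⁻⁵`) is in the output mode at some time in the window
`[1.0819, 1.4142]` and essentially none before it — a DELAYED, ABRUPT PULSE, for every admissible
forcing, uniformly over the input box.  The design (unforced, point input) transfers 92.5 %; the
exact-rational twin of the forced box flow gives 92.24 %.

PROOF.  `TubeTableRun0 … 7` kernel-evaluate the tube checker `runTube` (`TubeCheck.lean`) on the 48
chunks of the schedule (`run_0 … run_47`, `decide +kernel`), `runTube_chunks` chains them (`run_allT`),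
`runTube_crossing` (soundness of the checker, `TubeCheck.lean`, on top of the one-step tube theorem
`TubeStep.tube_step`) gives the cube bound, the crossing time (intermediate value theorem on the
trigger) and the hull; `slavingResidual_mem_of_box` and `IsForcedWindow.energy_abs_sub_le` place the
crossing state in `AintL`; `IsForcedWindow.shift` restarts the curve there and
`ThresholdLevelTableL.recut_transfer_reach` finishes.  Sorry-free; standard axioms only; no
`native_decide`.

WHAT THIS IS NOT.  Not the drain stage (stage 4: the loaded output must still be shown to leave
through `ã` while `a, b, c, d` decay — uncertified), not the GATE verdict of `ThresholdGate.lean`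
(whose cascade form needs stage 4 and the timing hand-off to the next gate; the "no input ⇒ no
output" branch IS here, as `noInput_quiet`), not a
statement about the averaged or the true Navier–Stokes equations, not evidence for blow-up.  One gate,
one design point, abstract forcing.
-/

noncomputable section

open Set

namespace Literature.Analysis.FluidPDE.FluidComputer

open Literature.Analysis.FluidPDE.Tao2016AveragedNS

namespace TubeTable

open ThresholdLevelTable (GIt RbIt Gt Gt_valid GIt_mem Rbt RbIt_mem)
open ThresholdLevelTableL (LtL T₃L EoutL AintL recut_transfer_reach LtL_B_zero LtL_C_zero)

/-- The whole tube run: all 48 chunks pass, from the input state `sT 0` to the final state `sT 48`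
(crossing flag set, hull `HT`). [folklore] -/
theorem run_allT : runTube 60 12 GIt CLt Rt (sT 0) schedT = some (sT NT) :=
  runTube_chunks sT cT NT (by
    intro i hi
    simp only [NT] at hi
    interval_cases i
    · exact run_0
    · exact run_1
    · exact run_2
    · exact run_3
    · exact run_4
    · exact run_5
    · exact run_6
    · exact run_7
    · exact run_8
    · exact run_9
    · exact run_10
    · exact run_11
    · exact run_12
    · exact run_13
    · exact run_14
    · exact run_15
    · exact run_16
    · exact run_17
    · exact run_18
    · exact run_19
    · exact run_20
    · exact run_21
    · exact run_22
    · exact run_23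
    · exact run_24
    · exact run_25
    · exact run_26
    · exact run_27
    · exact run_28
    · exact run_29
    · exact run_30
    · exact run_31
    · exact run_32
    · exact run_33
    · exact run_34
    · exact run_35
    · exact run_36
    · exact run_37
    · exact run_38
    · exact run_39
    · exact run_40
    · exact run_41
    · exact run_42
    · exact run_43
    · exact run_44
    · exact run_45
    · exact run_46
    · exact run_47)

/-- The gate's INPUT BOX (real form of `B0t`): carrier `a ∈ [1 − 10⁻⁵, 1 + 10⁻⁵]`, clock
`|b| ≤ 10⁻⁵`, trigger `c ∈ [0, 10⁻⁷]`, and `2d² + ã² ≤ 7.5·10⁻¹¹` (outward-rounded at scale `2^60`).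
[folklore] -/
def InputBox : Set (Fin 5 → ℝ) := {X | (B0t.toR 60).mem X}

/-- A readable sufficient condition for membership in the input box. [folklore] -/
theorem mem_inputBox_of {X : Fin 5 → ℝ} (ha : |X 0 - 1| ≤ 1 / 10 ^ 5) (hb : |X 1| ≤ 1 / 10 ^ 5)
    (hc : 0 ≤ X 2 ∧ X 2 ≤ 1 / 10 ^ 7) (hd : |X 3| ≤ 5 / 10 ^ 6) (hz : |X 4| ≤ 5 / 10 ^ 6) :
    X ∈ InputBox := by
  obtain ⟨ha1, ha2⟩ := abs_le.1 ha
  obtain ⟨hb1, hb2⟩ := abs_le.1 hb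
  have hd2 : X 3 ^ 2 ≤ (5 / 10 ^ 6) ^ 2 := by
    rw [← sq_abs]; exact pow_le_pow_left₀ (abs_nonneg _) hd 2
  have hz2 : X 4 ^ 2 ≤ (5 / 10 ^ 6) ^ 2 := by
    rw [← sq_abs]; exact pow_le_pow_left₀ (abs_nonneg _) hz 2
  refine ⟨⟨?_, ?_⟩, ⟨?_, ?_⟩, ⟨?_, ?_⟩, ?_⟩
  all_goals simp only [TubeBoxD.toR, B0t]
  all_goals push_cast
  · linarith
  · linarith
  · linarith
  · linarith
  · linarith [hc.1]
  · linarith [hc.2]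
  · nlinarith

/-- The input box is inhabited (e.g. by the nominal input `(1, 0, 5·10⁻⁸, 0, 0)`). [folklore] -/
theorem inputBox_nonempty : InputBox.Nonempty := by
  refine ⟨![1, 0, 1 / (2 * 10 ^ 7), 0, 0], mem_inputBox_of ?_ ?_ ?_ ?_ ?_⟩
  all_goals
    simp only [Fin.isValue, Matrix.cons_val_zero, Matrix.cons_val_one, Matrix.cons_val]
  all_goals norm_num

/-- The read-out trigger level `C₋ = CLt/2^60 ≈ 1.0206·10⁻⁴` (the re-cut table's level `0`).
[folklore] -/
def Cminus : ℝ := (CLt : ℝ) / 2 ^ 60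

/-- `C₋` is the level-`0` trigger level of the re-cut table. [folklore] -/
theorem Cminus_eq : Cminus = LtL.C 0 := by
  rw [LtL_C_zero]; norm_num [Cminus, CLt]

/-- The schedule is not empty. [folklore] -/
theorem schedT_ne_nil : schedT ≠ [] := by decide

/-- The cube radius of the run is the mode-ball radius `Rbt`. [folklore] -/
theorem Rt_eq : ((Rt : ℤ) : ℝ) / 2 ^ 60 = Rbt := by norm_num [Rt, Rbt]

/-- **STAGES 1–2 (tube + crossing).**  Every `δ`-forced curve from the input box stays in the cube
`‖·‖∞ ≤ Rbt` on `[0, T12t]` and reaches the read-out level `C₋` at some `s < T12t` with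
`(a, b, d, ã)` in the hull box `HT`. [folklore] -/
theorem tube_crossing {y : ℝ → Fin 5 → ℝ}
    (hW : IsForcedWindow Gt.ε Gt.σ Gt.ν Gt.μ Gt.r Gt.κ Gt.δ T12t y) (h0 : y 0 ∈ InputBox) :
    (∀ t ∈ Icc 0 T12t, ∀ i, |y t i| ≤ Rbt) ∧
      ∃ s ∈ Ico 0 T12t, y s 2 = Cminus ∧ HT.memR 60 (y s) := by
  rw [← dur_schedT] at hW
  have h := runTube_crossing (P := 60) (n := 12) (by norm_num) GIt_mem Gt_valid run_allT
    schedT_ne_nil levels_lt.1 levels_lt.2 hW h0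
  rw [dur_schedT, Rt_eq] at h
  exact h

/-- The state at the end of the tube lies in the final cross-section `BNt`. [folklore] -/
theorem tube_final {y : ℝ → Fin 5 → ℝ}
    (hW : IsForcedWindow Gt.ε Gt.σ Gt.ν Gt.μ Gt.r Gt.κ Gt.δ T12t y) (h0 : y 0 ∈ InputBox) :
    (BNt.toR 60).mem (y T12t) := by
  rw [← dur_schedT] at hW ⊢
  exact (runTube_sound (P := 60) (n := 12) (by norm_num) GIt_mem Gt_valid CLt Rt schedT (sT 0)
    (sT NT) run_allT y hW h0).1

/-- **TIMING: no early output.**  Before `T12t = 8863/8192 ≈ 1.0819` the output mode carries at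
most `0.14 %` of the energy: `ã(t)² ≤ 1.4·10⁻³` on `[0, T12t]` (the final cross-section bounds
`ã(T12t) ≤ 0.037`, and `ã + δt` is nondecreasing, `ã − ã(0) ≥ −δt`). [folklore] -/
theorem tube_no_early_output {y : ℝ → Fin 5 → ℝ}
    (hW : IsForcedWindow Gt.ε Gt.σ Gt.ν Gt.μ Gt.r Gt.κ Gt.δ T12t y) (h0 : y 0 ∈ InputBox) :
    ∀ t ∈ Icc 0 T12t, y t 4 ^ 2 ≤ 14 / 10 ^ 4 := by
  intro t ht
  have hT : (0 : ℝ) ≤ T12t := by norm_num [T12t]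
  obtain ⟨-, -, -, hV⟩ := tube_final hW h0
  simp only [TubeBoxD.toR, BNt] at hV
  push_cast at hV
  have hsq : (y T12t 4 - 41883609725165693 / 2 ^ 60) ^ 2 ≤ ((6 : ℝ) / 10 ^ 4) ^ 2 := by
    have hVle : (313081695904 : ℝ) / 2 ^ 60 ≤ ((6 : ℝ) / 10 ^ 4) ^ 2 := by norm_num
    nlinarith [sq_nonneg (y T12t 3 - 7602702815125684 / 2 ^ 60)]
  have hzT := (abs_le_of_sq_le_sq' hsq (by norm_num)).2
  obtain ⟨-, -, -, gV⟩ := h0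
  simp only [TubeBoxD.toR, B0t] at gV
  push_cast at gV
  have hsq0 : (y 0 4 - 0 / 2 ^ 60) ^ 2 ≤ ((1 : ℝ) / 10 ^ 5) ^ 2 := by
    have hVle : (86469113 : ℝ) / 2 ^ 60 ≤ ((1 : ℝ) / 10 ^ 5) ^ 2 := by norm_num
    nlinarith [sq_nonneg (y 0 3 - 0 / 2 ^ 60)]
  have hz0 := (abs_le_of_sq_le_sq' hsq0 (by norm_num)).1
  have hup := hW.output_ge_affine_from (by norm_num [Gt]) ht T12t ⟨ht.2, le_rfl⟩
  have hlow := hW.output_ge_affine (by norm_num [Gt]) t ht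
  have hδ1 : Gt.δ * (T12t - t) ≤ Gt.δ * T12t :=
    mul_le_mul_of_nonneg_left (by linarith [ht.1]) (by norm_num [Gt])
  have hδ2 : Gt.δ * t ≤ Gt.δ * T12t := mul_le_mul_of_nonneg_left ht.2 (by norm_num [Gt])
  have hδT : Gt.δ * T12t ≤ 4 / 10 ^ 6 := by norm_num [Gt, T12t]
  simp only [Gt] at hδ1 hδ2 hδT hup hlow
  have habs : |y t 4| ≤ 37 / 10 ^ 3 := abs_le.2 ⟨by linarith, by linarith⟩
  calc y t 4 ^ 2 = |y t 4| ^ 2 := (sq_abs _).symm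
    _ ≤ ((37 : ℝ) / 10 ^ 3) ^ 2 := pow_le_pow_left₀ (abs_nonneg _) habs 2
    _ ≤ 14 / 10 ^ 4 := by norm_num

/-- **HAND-OFF.**  The crossing state lies in the entry box `AintL` of the re-cut transfer table:
carrier, clock and output from the hull, trigger `= C₋`, slaving residual `w = κ d ã − r c a` by the
interval product over the hull, energy within `10 δ Rbt T12t` of the input energy. [folklore] -/
theorem tube_handoff {y : ℝ → Fin 5 → ℝ}
    (hW : IsForcedWindow Gt.ε Gt.σ Gt.ν Gt.μ Gt.r Gt.κ Gt.δ T12t y) (h0 : y 0 ∈ InputBox) :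
    ∃ s ∈ Ico 0 T12t, (LtL.B 0).mem Gt.κ Gt.r (LtL.C 0) (y s) := by
  obtain ⟨hcube, s, hs, hc, hH⟩ := tube_crossing hW h0
  refine ⟨s, hs, ?_⟩
  obtain ⟨⟨ha1, ha2⟩, ⟨hb1, hb2⟩, ⟨hd1, hd2⟩, ⟨hz1, hz2⟩⟩ := hH
  simp only [HT] at ha1 ha2 hb1 hb2 hd1 hd2 hz1 hz2
  push_cast at ha1 ha2 hb1 hb2 hd1 hd2 hz1 hz2
  have hc' : y s 2 = (117685124146233 : ℝ) / 2 ^ 60 := by rw [hc]; norm_num [Cminus, CLt]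
  -- slaving residual by interval product over the hull
  have hw := slavingResidual_mem_of_box (κ := Gt.κ) (r := Gt.r) (by norm_num [Gt]) (by norm_num [Gt])
    (by norm_num) (by norm_num) (by norm_num) (by norm_num) ⟨ha1, ha2⟩ ⟨hc'.ge, hc'.le⟩ ⟨hd1, hd2⟩
    ⟨hz1, hz2⟩
  simp only [Gt] at hw
  -- energy: input energy band and drift
  have hE0 : (1152909975391800907 : ℝ) ^ 2 / (2 ^ 60) ^ 2 ≤ energy (y 0) ∧
      energy (y 0) ≤ ((1152933033821893045 : ℝ) ^ 2 + 11529215046069 ^ 2 + 115292150461 ^ 2) /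
        (2 ^ 60) ^ 2 + 86469113 / 2 ^ 60 := by
    obtain ⟨⟨ga1, ga2⟩, ⟨gb1, gb2⟩, ⟨gc1, gc2⟩, gV⟩ := h0
    simp only [TubeBoxD.toR, B0t] at ga1 ga2 gb1 gb2 gc1 gc2 gV
    push_cast at ga1 ga2 gb1 gb2 gc1 gc2 gV
    rw [Ignition.energy_five]
    constructor
    · nlinarith [sq_nonneg (y 0 1), sq_nonneg (y 0 2), sq_nonneg (y 0 3), sq_nonneg (y 0 4)]
    · nlinarith [sq_nonneg (y 0 3)]
  have hdrift := hW.energy_abs_sub_le (R := Rbt) (by norm_num [Rbt])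
    (fun t ht i => hcube t ⟨ht.1, ht.2.le⟩ i) s ⟨hs.1, hs.2.le⟩
  obtain ⟨hdr1, hdr2⟩ := abs_le.1 hdrift
  have hsT : s ≤ 8863 / 8192 := by have := hs.2; norm_num [T12t] at this; exact this.le
  have hδR : 10 * (Gt.δ * Rbt) * s ≤ 10 * (Gt.δ * Rbt) * (8863 / 8192) :=
    mul_le_mul_of_nonneg_left hsT (by norm_num [Gt, Rbt])
  simp only [Gt, Rbt] at hδR hdr1 hdr2
  rw [LtL_B_zero, LtL_C_zero]
  refine ⟨⟨?_, ?_⟩, ⟨?_, ?_⟩, ?_, ⟨?_, ?_⟩, ⟨?_, ?_⟩, ⟨?_, ?_⟩⟩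
  all_goals try simp only [LevelEntryD.toReal, ThresholdLevelTableL.Bc0]
  all_goals try push_cast
  · exact ha1
  · exact ha2
  · exact hb1
  · exact hb2
  · exact hc'
  · simp only [Gt]; linarith [hw.1]
  · simp only [Gt]; linarith [hw.2]
  · exact hz1
  · exact hz2
  · nlinarith [hE0.1]
  · nlinarith [hE0.2]

/-- **THE GATE RUNS: input box ⇒ loaded output, under forcing.**  Every curve that is continuous and
right-differentiable with forcing defect `≤ Gt.δ ≈ 3.58·10⁻⁶` on `[0, T12t + T₃L] ≈ [0, 1.4142]` and
starts in the input box loads the output mode to `y s 4 ^ 2 ≥ EoutL ≈ 0.92240` (at least 92.2 % of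
the pulse energy) at some time `s ≤ T12t + T₃L`.  [cite: Tao2016AveragedNS, §5.5 Thm 5.3 (5.5)] -/
theorem inputBox_reach_outputLoaded {y : ℝ → Fin 5 → ℝ} (h0 : y 0 ∈ InputBox)
    (hcont : ContinuousOn y (Icc 0 (T12t + T₃L)))
    (hder : ∀ s ∈ Ico 0 (T12t + T₃L), ∃ W : Fin 5 → ℝ, HasDerivWithinAt y W (Ici s) s ∧
      ‖W - thresholdCircuit Gt.ε Gt.σ Gt.ν Gt.μ Gt.r Gt.κ (y s)‖ ≤ Gt.δ) :
    ∃ s ∈ Icc 0 (T12t + T₃L), EoutL ≤ y s 4 ^ 2 := by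
  have hW : IsForcedWindow Gt.ε Gt.σ Gt.ν Gt.μ Gt.r Gt.κ Gt.δ (T12t + T₃L) y := ⟨hcont, hder⟩
  have hT3 : 0 ≤ T₃L := by norm_num [T₃L]
  obtain ⟨s, hs, hmem⟩ := tube_handoff (hW.mono (by linarith)) h0
  have hW3 : IsForcedWindow Gt.ε Gt.σ Gt.ν Gt.μ Gt.r Gt.κ Gt.δ T₃L (fun t => y (s + t)) :=
    (hW.shift ⟨hs.1, by linarith [hs.2]⟩).mono (by linarith [hs.2])
  obtain ⟨t, ht, hout⟩ := recut_transfer_reach hmem (x := fun t => y (s + t)) (by simp)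
    hW3.continuousOn hW3.defect
  exact ⟨s + t, ⟨by linarith [hs.1, ht.1], by linarith [hs.2, ht.2]⟩, hout⟩

/-- The same in `IsForcedWindow` form. [folklore] -/
theorem inputBox_reach_outputLoaded' {y : ℝ → Fin 5 → ℝ}
    (hW : IsForcedWindow Gt.ε Gt.σ Gt.ν Gt.μ Gt.r Gt.κ Gt.δ (T12t + T₃L) y) (h0 : y 0 ∈ InputBox) :
    ∃ s ∈ Icc 0 (T12t + T₃L), EoutL ≤ y s 4 ^ 2 :=
  inputBox_reach_outputLoaded h0 hW.continuousOn hW.defect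

/-- The numbers: the output load is at least `0.9224`, the input energy at most `1 + 3·10⁻⁵`, so at
least `92.2 %` of the energy is transferred; the pulse emerges in the window `[1.0819, 1.4142]`
(no early output before `T12t ≥ 1.0819`, loaded by `T12t + T₃L ≤ 1.4142`). [folklore] -/
theorem certificate_numbers :
    (0.9224 : ℝ) ≤ EoutL ∧ (1.0819 : ℝ) ≤ T12t ∧ T12t + T₃L ≤ 1.4142 ∧
      ∀ X ∈ InputBox, energy X ≤ 1 + 3 / 10 ^ 5 := by
  refine ⟨by norm_num [EoutL], by norm_num [T12t], by norm_num [T12t, T₃L], fun X hX => ?_⟩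
  obtain ⟨⟨ga1, ga2⟩, ⟨gb1, gb2⟩, ⟨gc1, gc2⟩, gV⟩ := hX
  simp only [TubeBoxD.toR, B0t] at ga1 ga2 gb1 gb2 gc1 gc2 gV
  push_cast at ga1 ga2 gb1 gb2 gc1 gc2 gV
  rw [Ignition.energy_five]
  nlinarith [sq_nonneg (X 3)]

/-! ### The complementary (quiet) branch at the design point -/

/-- **No input pulse ⇒ no output**, at the design point and over the same window as
`inputBox_reach_outputLoaded`: if the initial energy is at most `e ≤ 1`, then for EVERY forcing of
defect `≤ Gt.δ` the output mode carries at most `e + 6·10⁻⁵` of energy at ALL times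
`t ∈ [0, T12t + T₃L]` (`IsForcedWindow.quiet_output` with `R_b = Rbt`: drift `10·Gt.δ·Rbt·1.4142 ≤ 6·10⁻⁵`).
Together with the reach branch this is the gate's dichotomy on the pulse energy, for the 5-mode
truncated circuit with an abstract defect; it does not certify stage 4 or the cascade. [folklore] -/
theorem noInput_quiet {y : ℝ → Fin 5 → ℝ} {e : ℝ} (he : energy (y 0) ≤ e) (he1 : e ≤ 1)
    (hcont : ContinuousOn y (Icc 0 (T12t + T₃L)))
    (hder : ∀ s ∈ Ico 0 (T12t + T₃L), ∃ W : Fin 5 → ℝ, HasDerivWithinAt y W (Ici s) s ∧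
      ‖W - thresholdCircuit Gt.ε Gt.σ Gt.ν Gt.μ Gt.r Gt.κ (y s)‖ ≤ Gt.δ) :
    ∀ t ∈ Icc 0 (T12t + T₃L), y t 4 ^ 2 ≤ e + 6 / 10 ^ 5 := by
  have hW : IsForcedWindow Gt.ε Gt.σ Gt.ν Gt.μ Gt.r Gt.κ Gt.δ (T12t + T₃L) y := ⟨hcont, hder⟩
  have hT : T12t + T₃L ≤ 1.4142 := certificate_numbers.2.2.1
  have hT0 : (0 : ℝ) ≤ T12t + T₃L := by norm_num [T12t, T₃L]
  have hδ0 : (0 : ℝ) ≤ Gt.δ := by norm_num [Gt]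
  have hRb : (0 : ℝ) < Rbt := by norm_num [Rbt]
  have hdr : 10 * (Gt.δ * Rbt) * (T12t + T₃L) ≤ 6 / 10 ^ 5 := by
    have h1 : 10 * (Gt.δ * Rbt) ≤ 4 / 10 ^ 5 := by norm_num [Gt, Rbt]
    nlinarith
  have hRb2 : (106 : ℝ) / 100 ≤ Rbt ^ 2 := by norm_num [Rbt]
  have hE : energy (y 0) + 10 * (Gt.δ * Rbt) * (T12t + T₃L) < Rbt ^ 2 := by linarith
  intro t ht
  have h1 := hW.quiet_output hT0 hδ0 hRb hE t ht
  have h2 : 10 * (Gt.δ * Rbt) * t ≤ 10 * (Gt.δ * Rbt) * (T12t + T₃L) :=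
    mul_le_mul_of_nonneg_left ht.2 (by positivity)
  linarith

end TubeTable

end Literature.Analysis.FluidPDE.FluidComputer

end
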